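import Mathlib
import HarnessLib
import Summits.AtomisticToContinuum.FouriersLaw.Theses.JunctionLocality

/-!
# Coupling transfer for `ConductanceLowerBound` (crux stmt-AtomisticToContinuum-11749) — gen-2 tool

`CouplingTransfer`: for the pinned chain at two bath couplings `γ, γ' > 0` (same `ω₂, lam, β, T`), the
finite-`N` response coefficients satisfy `min(γ/γ', γ'/γ) · D'_N ≤ D_N` for every `N`.  Source of the
inequality: the Stieltjes-in-`γ` structure of the two-terminal conductance, `G_N(γ) = aγ + γ∫dμ̂_N(s)/(γ²+s²)`
with a `γ`-FREE positive measure (`L_γ = A − γP`, `P ≥ 0` the `γ`-free Ornstein–Uhlenbeck number operator of the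
two contact momenta; symmetrised resolvent `= γ P^{-1/2}(γ² + |𝔸|²)^{-1}P^{-1/2}`, `𝔸 = P^{-1/2}AP^{-1/2}` skew and
`γ`-free; `g_N = γ/2 − γ²S_w/(4T²)` with `S_w = ⟨w,(γP−A)^{-1}_{sym}w⟩`, `w = p₀² − p²_{N−1}`), whence `G/γ` is
decreasing and `γG` increasing in `γ`.  Consequence (`conductanceLowerBound_of_singleCoupling`): the crux follows from
its restriction to ONE coupling `γ⋆(ω₂, lam, β, T)` per parameter point, given the route's support items
`NessUnique` and `FiniteResponseOfUnique` (needed to produce the comparison family at `γ⋆`).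
-/

noncomputable section

open MeasureTheory Filter Topology Set

namespace Summit.AtomisticToContinuum.FouriersLaw.Cruxes.ConductanceLowerBound.Coupling

open Literature.MathematicalPhysics.KineticTheory.HeatConduction
open Summit.AtomisticToContinuum.FouriersLaw.Theses.JunctionLocality

/-- Weak-NESS uniqueness at one parameter point. -/
def UniqAt (ω₂ lam β γ : ℝ) : Prop :=
  ∀ (N : ℕ) (T_L T_R : ℝ), 0 < T_L → 0 < T_R → ∀ μ ν : Measure (PhaseSpace N),
    (pinnedChain ω₂ lam β γ).IsSteadyState N T_L T_R μ →
    (pinnedChain ω₂ lam β γ).IsSteadyState N T_L T_R ν → μ = ν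

/-- Steady-state family at one parameter point. -/
def IsSteadyFamily (ω₂ lam β γ : ℝ) (μ : (N : ℕ) → ℝ → ℝ → Measure (PhaseSpace N)) : Prop :=
  ∀ (N : ℕ) (T_L T_R : ℝ), 0 < T_L → 0 < T_R →
    (pinnedChain ω₂ lam β γ).IsSteadyState N T_L T_R (μ N T_L T_R)

/-- Response sequence of a family at temperature `T`. -/
def IsResponse (ω₂ lam β γ : ℝ) (μ : (N : ℕ) → ℝ → ℝ → Measure (PhaseSpace N)) (T : ℝ)
    (D : ℕ → ℝ) : Prop :=
  ∀ N : ℕ, Tendsto (fun δ : ℝ =>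
    (pinnedChain ω₂ lam β γ).totalCurrent (μ N (T + δ / 2) (T - δ / 2)) / δ) (𝓝[≠] 0) (𝓝 (D N))

/-- COUPLING TRANSFER (theorem-grade target; Stieltjes-in-γ): at fixed `ω₂, lam, β, T`, the responses at
couplings `γ, γ'` compare through `min(γ/γ', γ'/γ)`. -/
def CouplingTransfer : Prop :=
  ∀ ω₂ lam β : ℝ, 0 < ω₂ → 0 < lam → 0 < β → ∀ γ γ' : ℝ, 0 < γ → 0 < γ' →
    UniqAt ω₂ lam β γ → UniqAt ω₂ lam β γ' →
    ∀ μ μ' : (N : ℕ) → ℝ → ℝ → Measure (PhaseSpace N),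
      IsSteadyFamily ω₂ lam β γ μ → IsSteadyFamily ω₂ lam β γ' μ' →
      ∀ T : ℝ, 0 < T → ∀ D D' : ℕ → ℝ,
        IsResponse ω₂ lam β γ μ T D → IsResponse ω₂ lam β γ' μ' T D' →
        ∀ N : ℕ, min (γ / γ') (γ' / γ) * D' N ≤ D N

/-- The crux restricted to a single coupling `γ⋆(ω₂, lam, β, T)` per parameter point. -/
def LowerBoundAtCoupling (γstar : ℝ → ℝ → ℝ → ℝ → ℝ) : Prop :=
  ∀ ω₂ lam β : ℝ, 0 < ω₂ → 0 < lam → 0 < β → ∀ T : ℝ, 0 < T →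
    0 < γstar ω₂ lam β T ∧
    (UniqAt ω₂ lam β (γstar ω₂ lam β T) →
      ∀ μ : (N : ℕ) → ℝ → ℝ → Measure (PhaseSpace N),
        IsSteadyFamily ω₂ lam β (γstar ω₂ lam β T) μ →
        ∀ D : ℕ → ℝ, IsResponse ω₂ lam β (γstar ω₂ lam β T) μ T D →
          ∃ c : ℝ, 0 < c ∧ ∃ N₁ : ℕ, ∀ N : ℕ, N₁ ≤ N → c ≤ D N)

/-- **WLOG one coupling.**  Given the route supports `NessUnique` and `FiniteResponseOfUnique` (to manufacture the
comparison family and its response at `γ⋆`) and `CouplingTransfer`, the single-coupling lower bound implies the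
crux, with `c(γ) = min(γ/γ⋆, γ⋆/γ) · c(γ⋆)`. -/
theorem conductanceLowerBound_of_singleCoupling (hU : NessUnique) (hR : FiniteResponseOfUnique)
    (hT : CouplingTransfer) {γstar : ℝ → ℝ → ℝ → ℝ → ℝ} (h : LowerBoundAtCoupling γstar) :
    ConductanceLowerBound := by
  intro ω₂ lam β γ hω hl hβ hγ huniq μ hμ T hT0 D hD
  obtain ⟨hγs, hstar⟩ := h ω₂ lam β hω hl hβ T hT0
  set γ' := γstar ω₂ lam β T with hγ'
  -- comparison family at γ': existence (proved fact) + uniqueness (support) + response (support)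
  have huniq' : UniqAt ω₂ lam β γ' := hU ω₂ lam β γ' hω hl hβ hγs
  have hex : ∀ (N : ℕ) (T_L T_R : ℝ), 0 < T_L → 0 < T_R →
      ∃ ν : Measure (PhaseSpace N), (pinnedChain ω₂ lam β γ').IsSteadyState N T_L T_R ν :=
    fun N T_L T_R hL' hR' => pinnedChain_exists_isSteadyState hω hl hβ hγs N hL' hR'
  classical
  let μ' : (N : ℕ) → ℝ → ℝ → Measure (PhaseSpace N) :=
    fun N T_L T_R => if hh : 0 < T_L ∧ 0 < T_R then Classical.choose (hex N T_L T_R hh.1 hh.2) else 0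
  have hμ' : IsSteadyFamily ω₂ lam β γ' μ' := by
    intro N T_L T_R hL' hR'
    simp only [μ', dif_pos (And.intro hL' hR')]
    exact Classical.choose_spec (hex N T_L T_R hL' hR')
  have hDex := hR ω₂ lam β γ' hω hl hβ hγs huniq' μ' hμ' T hT0
  choose D' hD' using hDex
  obtain ⟨c', hc', N₁, hN₁⟩ := hstar huniq' μ' hμ' D' hD'
  have hmin : 0 < min (γ / γ') (γ' / γ) := lt_min (div_pos hγ hγs) (div_pos hγs hγ)
  refine ⟨min (γ / γ') (γ' / γ) * c', mul_pos hmin hc', N₁, fun N hN => ?_⟩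
  have htr := hT ω₂ lam β hω hl hβ γ γ' hγ hγs huniq huniq' μ μ' hμ hμ' T hT0 D D' hD hD' N
  calc min (γ / γ') (γ' / γ) * c' ≤ min (γ / γ') (γ' / γ) * D' N :=
        mul_le_mul_of_nonneg_left (hN₁ N hN) hmin.le
    _ ≤ D N := htr

end Summit.AtomisticToContinuum.FouriersLaw.Cruxes.ConductanceLowerBound.Coupling

end
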